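import Literature.Computability.QuantumComplexity.GRData
import Literature.Computability.QuantumComplexity.GRCosineCodeFP
import Literature.Computability.QuantumComplexity.CleanBlockInput
import HarnessLib

/-!
# The cosine machine of the concrete Grover–Rudolph block: `GRData.Mach` for the mass-table cosines

Topic `Literature/Computability/QuantumComplexity`; the sequel announced in `GRCosineCodeFP.lean`
("the raw-string parser of the machine's input `d ++ v` and the `FP` machine") and the machine datum
`GRData.Mach` of `GRData.lean` for Regev's sampler (Lemma 3.12, proof: the rotation of level `j` of the
Grover–Rudolph state preparation has cosine `A/2ᵏ` with `A = aOf k (T j h) (T (j+1) (2h))` computed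
"efficiently" from the prefix value `h` and the mass table `T`; §2 p. 11, finite precision). ONE fixed
machine serves every instance: the data word of level `j` is the prefix `y₀ … y_{j−1}` followed by the
`np` PARAMETER wires holding the self-delimited code of `((S, (p, U)), (k, ℓ))` padded with `0`
(`GRData`: parameters on wires, not in the circuit, for uniformity), and the constant suffix is
`CleanBlockInput.suffix 1ʲ (j + np)`:

* `fLevel` (the `FP` function of `GRCosineCodeFP.codeFP_levelWord`), the level function `F j d`
  (parse: `fstF (d.drop j)` = the parameter code, `⟦reverse (d.take j)⟧` = the prefix value
  `GaussianCells.hiVal`, `GRCosineWord.hiVal_eq_bitsToNat_reverse`) with **`codeFP_F`** and `F_apply`;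
* the machine `cosE`, `cosM` (`CleanBlockInput.exists_blockMachine`) with `cosM_outputs`;
* the parameter word `pcode`, `cword` (`ofFn_cword`, `fstF_pcode_append`, `k_le_length_pcode`);
* the suffixes `v`, the window `wlen` (`width_le_wlen`), and **`GRCosineMach.mach`**
  `: GRData.Mach ℓ np (wlen ℓ np) (k+1) (fun j y => machineA k (tableT S p U ℓ) j y / 2ᵏ)` for every
  `np ≥ |pcode|`, with `abs_cosA_le_one`, `cosA_update` and the block `Data` **`GRCosineMach.data`**.

Everything here is proved; definitions have bodies; no named fact is introduced.

## References

* O. Regev, *On lattices, learning with errors, random linear codes, and cryptography*, J. ACM 56 (2009),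
  art. 34, Lemma 3.12 (proof) and §2 p. 11 [Regev2009].
* L. Grover, T. Rudolph, *Creating superpositions that correspond to efficiently integrable probability
  distributions*, arXiv:quant-ph/0208112 (2002), eq. (1)–(4) [GroverRudolph2002].
* S. Arora, B. Barak, *Computational Complexity: A Modern Approach*, CUP 2009, §1.3 [AroraBarak2009].
-/

noncomputable section

namespace Literature.Computability.QuantumComplexity

open Literature.Computability.Complexity Literature.Computability.Complexity.CodeFP Literature.Computability.Complexity.Brick
open _root_.Computability GaussianCells GRMassTable GRCosineCodeFP CleanBlockInput RevSim RevClean Turing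

namespace GRCosineMach

/-! ### The level function on strings -/

/-- The `FP` function of the level word on codes (`codeFP_levelWord`). [cite: Regev2009, Lemma 3.12 (proof)] -/
def fLevel : List Bool → List Bool := Classical.choose codeFP_levelWord

/-- It is polynomial time. [cite: AroraBarak2009, §1.3] -/
theorem fLevel_mem_FP : fLevel ∈ FP := (Classical.choose_spec codeFP_levelWord).1

/-- Its value on a level-input code. [cite: Regev2009, Lemma 3.12 (proof)] -/
theorem fLevel_apply (q : LevelIn) : fLevel (inE q) =
    wordOfNat q.1.2.1 (aOf q.1.2.1 (tableT' q.1.1.1 q.1.1.2.1 q.1.1.2.2 q.1.2.2 q.2.1 q.2.2)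
      (tableT' q.1.1.1 q.1.1.2.1 q.1.1.2.2 q.1.2.2 (q.2.1 + 1) (2 * q.2.2))) :=
  (Classical.choose_spec codeFP_levelWord).2 q

/-- **The level function**: on the level `j` and a data word `d` (the `j` prefix bits, most significant
first, then the parameter word) — the parameter code `fstF (d.drop j)`, the prefix value `⟦reverse (d.take j)⟧`,
and the level word of `fLevel`. [cite: Regev2009, Lemma 3.12 (proof)] -/
def F (j : ℕ) (d : List Bool) : List Bool :=
  fLevel (boolPair (fstF (d.drop j)) (boolPair (unE j) (natE (bitsToNat (d.take j).reverse))))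

/-- **The level function is polynomial time on codes** (level unary, data verbatim). [cite: AroraBarak2009, §1.3] -/
theorem codeFP_F : CodeFP (pairE unE strE) strE (fun p : ℕ × List Bool => F p.1 p.2) := by
  have hj : CodeFP (pairE unE strE) unE (fun p : ℕ × List Bool => p.1) := fst _ _
  have hrev : CodeFP strE strE List.reverse := ⟨List.reverse, reverse_mem_FP, fun _ => rfl⟩
  have hfst : CodeFP strE strE fstF := ⟨fstF, fstF_mem_FP, fun _ => rfl⟩
  have hlev : CodeFP strE strE fLevel := ⟨fLevel, fLevel_mem_FP, fun _ => rfl⟩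
  have hbp : CodeFP (pairE strE strE) strE (fun p : List Bool × List Bool => boolPair p.1 p.2) :=
    ⟨id, PolyTimeComputable.id _, fun _ => rfl⟩
  have hw : CodeFP (pairE unE strE) strE (fun p : ℕ × List Bool => fstF (p.2.drop p.1)) := (hfst.comp strDrop :)
  have hh : CodeFP (pairE unE strE) natE (fun p : ℕ × List Bool => bitsToNat (p.2.take p.1).reverse) :=
    (strVal.comp (hrev.comp strTake) :)
  have hjs : CodeFP (pairE unE strE) strE (fun p : ℕ × List Bool => unE p.1) := (strOfUn.comp hj :)
  have hhs : CodeFP (pairE unE strE) strE (fun p : ℕ × List Bool => natE (bitsToNat (p.2.take p.1).reverse)) :=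
    (strOfNat.comp hh :)
  have hin : CodeFP (pairE unE strE) strE (fun p : ℕ × List Bool =>
      boolPair (fstF (p.2.drop p.1)) (boolPair (unE p.1) (natE (bitsToNat (p.2.take p.1).reverse)))) :=
    (hbp.comp (hw.pair (hbp.comp (hjs.pair hhs))) :)
  exact (hlev.comp hin).congr fun _ => rfl

/-! ### The parameter word -/

/-- The parameters `((S, (p, U)), (k, ℓ))` of the cosine machine. [folklore] -/
abbrev Par : Type := (ℚ × (ℕ × ℕ)) × (ℕ × ℕ)

/-- **The parameter code**: the self-delimited `parE` code `⟨parE P, ε⟩`. [cite: AroraBarak2009, §1.3] -/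
def pcode (P : Par) : List Bool := boolPair (parE P) []

/-- **The parameter word** on `np` wires: the parameter code right-padded with `0`. [folklore] -/
def cword (np : ℕ) (P : Par) : Fin np → Bool := fun t => (pcode P).getD t false

/-- The parameter word, listed, is the code followed by the padding. [folklore] -/
theorem ofFn_cword {np : ℕ} {P : Par} (h : (pcode P).length ≤ np) :
    List.ofFn (cword np P) = pcode P ++ List.replicate (np - (pcode P).length) false := by
  apply List.ext_getElem
  · simp only [List.length_ofFn, List.length_append, List.length_replicate]; omega
  · intro i h₁ h₂
    rw [List.getElem_ofFn]
    simp only [cword]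
    by_cases hi : i < (pcode P).length
    · rw [List.getElem_append_left hi, List.getD_eq_getElem _ _ hi]
    · push Not at hi
      rw [List.getElem_append_right hi, List.getElem_replicate, List.getD_eq_default _ _ hi]

/-- The parameter word reads the code (definitional; `cword` is made irreducible below so that unification
never unfolds it into the code's bits). [folklore] -/
theorem cword_apply (np : ℕ) (P : Par) (t : Fin np) : cword np P t = (pcode P).getD t false := rfl

attribute [irreducible] cword

/-- The first field of the padded code is the `parE` code. [cite: AroraBarak2009, §0.1] -/
theorem fstF_pcode_append (P : Par) (pad : List Bool) : fstF (pcode P ++ pad) = parE P := by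
  rw [pcode, show boolPair (parE P) [] ++ pad = boolPair (parE P) pad by simp [boolPair], fstF_boolPair]

/-- The code is longer than the cosine precision: `k + 1 ≤ |pcode|`. [folklore] -/
theorem k_le_length_pcode (S : ℚ) (p U k ℓ : ℕ) : k + 1 ≤ (pcode ((S, (p, U)), (k, ℓ))).length := by
  simp only [pcode, pairE_apply, length_boolPair, length_unE, List.length_nil]
  omega

/-- **The level function on a well-formed data word**: prefix `pre` of length `j`, then the padded code. [cite: Regev2009, Lemma 3.12 (proof)] -/
theorem F_apply (S : ℚ) (p U k ℓ j : ℕ) (pre pad : List Bool) (hpre : pre.length = j) :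
    F j (pre ++ (pcode ((S, (p, U)), (k, ℓ)) ++ pad)) =
      wordOfNat k (aOf k (tableT' S p U ℓ j (bitsToNat pre.reverse)) (tableT' S p U ℓ (j + 1) (2 * bitsToNat pre.reverse))) := by
  subst hpre
  rw [F, List.drop_left, List.take_left, fstF_pcode_append]
  exact fLevel_apply (((S, (p, U)), (k, ℓ)), (pre.length, bitsToNat pre.reverse))

/-! ### The machine -/

/-- One machine with a power time bound computes every level function on block inputs. [cite: AroraBarak2009, §1.3] -/
theorem exists_machine : ∃ (e : ℕ) (M : TM2ComputableAux Bool Bool), ∀ (j : ℕ) (d : List Bool),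
    M.OutputsWithin (d ++ suffix (unE j) d.length) (F j d) (Tn e (d ++ suffix (unE j) d.length).length) :=
  exists_blockMachine (qE := unE) codeFP_F

/-- **The time exponent of the cosine machine.** [folklore] -/
def cosE : ℕ := Classical.choose exists_machine

/-- **The cosine machine.** [cite: Regev2009, Lemma 3.12 (proof)] -/
def cosM : TM2ComputableAux Bool Bool := Classical.choose (Classical.choose_spec exists_machine)

/-- The cosine machine outputs the level word within the time bound. [cite: Regev2009, Lemma 3.12 (proof)] -/
theorem cosM_outputs (j : ℕ) (d : List Bool) :
    cosM.OutputsWithin (d ++ suffix (unE j) d.length) (F j d) (Tn cosE (d ++ suffix (unE j) d.length).length) :=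
  Classical.choose_spec (Classical.choose_spec exists_machine) j d

/-! ### Suffixes, the window, and the machine datum -/

/-- **The suffix of level `j`**: `1ʲ 0 1^{j+np+1}`. [folklore] -/
def v (np j : ℕ) : List Bool := suffix (unE j) (j + np)

/-- Length of the suffix. [folklore] -/
theorem length_v (np j : ℕ) : (v np j).length = j + (j + np + 2) := by
  rw [v, length_suffix, length_unE]

/-- **The window length**: the largest block width over the levels, above the data bits. [folklore] -/
def wlen (ℓ np : ℕ) : ℕ := Finset.univ.sup fun j : Fin ℓ => width cosE cosM (j + np + (v np j).length) - (j + np)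

/-- Every level's block fits in the window. [folklore] -/
theorem width_le_wlen {ℓ np : ℕ} (j : Fin ℓ) : width cosE cosM (j + np + (v np j).length) ≤ j + np + wlen ℓ np := by
  have h : width cosE cosM (j + np + (v np j).length) - (j + np) ≤ wlen ℓ np :=
    Finset.le_sup (f := fun j : Fin ℓ => width cosE cosM (j + np + (v np j).length) - (j + np)) (Finset.mem_univ j)
  omega

/-- All cells of the last layer are read out: `n ≤ JJ e M n`. [folklore] -/
theorem le_JJ (e : ℕ) (M : TM2ComputableAux Bool Bool) (n : ℕ) : n ≤ JJ e M n := by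
  unfold JJ Sn; omega

/-- The machine hypothesis, output half: level `j`, data length `j + np`. [cite: Regev2009, Lemma 3.12 (proof)] -/
theorem outputs_v (np j : ℕ) (d : List Bool) (hd : d.length = j + np) :
    cosM.OutputsWithin (d ++ v np j) (F j d) (Tn cosE (d.length + (v np j).length)) := by
  have h := cosM_outputs j d
  rw [List.length_append, hd] at h
  rw [hd]
  exact h

/-- The machine hypothesis, length half: on a data word whose parameter part is the parameter word the
level word has `k + 1` bits. [cite: Regev2009, Lemma 3.12 (proof) with §2 p. 11] -/
theorem length_F (S : ℚ) (p U k ℓ np : ℕ) (hnp : (pcode ((S, (p, U)), (k, ℓ))).length ≤ np) (j : ℕ) (d : List Bool)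
    (hd : d.length = j + np) (hc : d.drop j = List.ofFn (cword np ((S, (p, U)), (k, ℓ)))) : (F j d).length = k + 1 := by
  have hpre : (d.take j).length = j := by rw [List.length_take, hd]; omega
  have hsplit : d = d.take j ++ (pcode ((S, (p, U)), (k, ℓ)) ++ List.replicate (np - (pcode ((S, (p, U)), (k, ℓ))).length) false) := by
    rw [← ofFn_cword hnp, ← hc, List.take_append_drop]
  rw [hsplit, F_apply S p U k ℓ j (d.take j) _ hpre, wordOfNat_eq_cosWord, length_cosWord]

/-- **The machine hypothesis `MachOK` of every level.** [cite: Regev2009, Lemma 3.12 (proof)] -/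
theorem machOK (S : ℚ) (p U k ℓ np : ℕ) (hnp : (pcode ((S, (p, U)), (k, ℓ))).length ≤ np) (j : Fin ℓ) :
    GRWord.MachOK (GRData.kit ℓ np (wlen ℓ np) (k + 1)) cosE cosM (j + np) (v np j)
      (fun d => d.drop j = List.ofFn (cword np ((S, (p, U)), (k, ℓ)))) (F j) where
  out d hd _ := outputs_v np j d hd
  len d hd hc := by rw [length_F S p U k ℓ np hnp j d hd hc, GRData.kit_eq, GenKit.kit_k]

/-- The field cells fit in the read-out zone: `k + 1 ≤ JJ`. [folklore] -/
theorem k_le_JJ (S : ℚ) (p U k ℓ np : ℕ) (hnp : (pcode ((S, (p, U)), (k, ℓ))).length ≤ np) (j : ℕ) :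
    k + 1 ≤ JJ cosE cosM (j + np + (v np j).length) :=
  (k_le_length_pcode S p U k ℓ).trans (hnp.trans ((le_JJ cosE cosM (j + np + (v np j).length)).trans' (by omega)))

/-- **The field specification**: on the prefix of `y` followed by the parameter word the level word encodes
EXACTLY `machineA k T j y / 2ᵏ`. [cite: Regev2009, Lemma 3.12 (proof) with §2 p. 11] [cite: GroverRudolph2002, eq. (4)] -/
theorem aTil_F (S : ℚ) (p U k ℓ np : ℕ) (hnp : (pcode ((S, (p, U)), (k, ℓ))).length ≤ np) (j : Fin ℓ) (y : Fin ℓ → Bool) :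
    SLP.aTil (k + 1) (bitsToNat (F j ((List.ofFn fun i : Fin j => y ⟨i, lt_of_lt_of_le i.2 (le_of_lt j.2)⟩) ++
      List.ofFn (cword np ((S, (p, U)), (k, ℓ)))))) = (machineA k (tableT S p U ℓ) j y : ℝ) / 2 ^ k := by
  rw [ofFn_cword hnp, F_apply S p U k ℓ j _ _ (List.length_ofFn ..), ← hiVal_eq_bitsToNat_reverse y j (le_of_lt j.2),
    wordOfNat_eq_cosWord, aTil_cosWord (aOf_le _ _ _), machineA, tableT'_eq (le_of_lt j.2), tableT'_eq (Nat.succ_le_of_lt j.2)]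

/-- **The cosine machine datum of the concrete Grover–Rudolph block**: for the mass table
`tableT S p U ℓ` and precision `k`, on `np ≥ |pcode|` parameter wires holding `cword`, the field of
level `j` encodes EXACTLY the cosine `machineA k T j y / 2ᵏ`. [cite: Regev2009, Lemma 3.12 (proof) with §2 p. 11]
[cite: GroverRudolph2002, eq. (4)] -/
def mach (S : ℚ) (p U k ℓ np : ℕ) (hnp : (pcode ((S, (p, U)), (k, ℓ))).length ≤ np) :
    GRData.Mach ℓ np (wlen ℓ np) (k + 1) (fun j y => (machineA k (tableT S p U ℓ) j y : ℝ) / 2 ^ k) where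
  e := cosE
  M := cosM
  v j := v np j
  fbits j := F j
  c := cword np ((S, (p, U)), (k, ℓ))
  hM j := machOK S p U k ℓ np hnp j
  width_le j := width_le_wlen j
  k_le j := k_le_JJ S p U k ℓ np hnp j
  spec j y := aTil_F S p U k ℓ np hnp j y

/-- The cosine lies in `[−1, 1]` (hypothesis `ha` of `GRData.data`). [folklore] -/
theorem abs_cosA_le_one (k : ℕ) (T : MassTable) {ℓ : ℕ} (j : Fin ℓ) (y : Fin ℓ → Bool) :
    |(machineA k T j y : ℝ) / 2 ^ k| ≤ 1 := by
  obtain ⟨h0, h1⟩ := machineA_div_mem k T (j : ℕ) y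
  rw [abs_of_nonneg h0]; exact h1

/-- The cosine of level `j` does not read the bits from `j` on (hypothesis `hau` of `GRData.data`). [folklore] -/
theorem cosA_update (k : ℕ) (T : MassTable) {ℓ : ℕ} (j : Fin ℓ) (y : Fin ℓ → Bool) (b : Bool) :
    (machineA k T j (Function.update y j b) : ℝ) / 2 ^ k = (machineA k T j y : ℝ) / 2 ^ k := by
  unfold machineA; rw [hiVal_update j le_rfl]

/-- **The `Data` of the concrete Grover–Rudolph block with the cosine machine.** [cite: Regev2009, Lemma 3.12 (proof)] -/
def data (S : ℚ) (p U k ℓ np : ℕ) (hnp : (pcode ((S, (p, U)), (k, ℓ))).length ≤ np) :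
    GRBlock.Data (GRData.kit ℓ np (wlen ℓ np) (k + 1)) (GRData.ws ℓ np (wlen ℓ np) (k + 1)) (GRData.pw ℓ np (wlen ℓ np) (k + 1))
      (fun j y => (machineA k (tableT S p U ℓ) j y : ℝ) / 2 ^ k) :=
  GRData.data (mach S p U k ℓ np hnp) (Nat.succ_pos k) (abs_cosA_le_one k (tableT S p U ℓ)) (cosA_update k (tableT S p U ℓ))

/-- The parameter word of the datum (definitional). [folklore] -/
theorem mach_c (S : ℚ) (p U k ℓ np : ℕ) (hnp : (pcode ((S, (p, U)), (k, ℓ))).length ≤ np) :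
    (mach S p U k ℓ np hnp).c = cword np ((S, (p, U)), (k, ℓ)) := rfl

/-- The machine and the exponent of the datum are the one cosine machine and its exponent (definitional). [folklore] -/
theorem mach_M (S : ℚ) (p U k ℓ np : ℕ) (hnp : (pcode ((S, (p, U)), (k, ℓ))).length ≤ np) :
    (mach S p U k ℓ np hnp).M = cosM ∧ (mach S p U k ℓ np hnp).e = cosE := ⟨rfl, rfl⟩

/-- The suffixes of the datum (definitional). [folklore] -/
theorem mach_v (S : ℚ) (p U k ℓ np : ℕ) (hnp : (pcode ((S, (p, U)), (k, ℓ))).length ≤ np) (j : Fin ℓ) :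
    (mach S p U k ℓ np hnp).v j = v np j := rfl

/-- The output words of the datum (definitional). [folklore] -/
theorem mach_fbits (S : ℚ) (p U k ℓ np : ℕ) (hnp : (pcode ((S, (p, U)), (k, ℓ))).length ≤ np) (j : Fin ℓ) :
    (mach S p U k ℓ np hnp).fbits j = F j := rfl

end GRCosineMach

end Literature.Computability.QuantumComplexity

end
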